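import Summits.ValiantsHypothesis.ValiantsHypothesis.Theorems.LacunarySymmetroidMatrixDescartesCensusFrame
import Summits.ValiantsHypothesis.ValiantsHypothesis.Theorems.LacunarySymmetroidMatrixDescartesCensusCertificates
import Summits.ValiantsHypothesis.ValiantsHypothesis.Theorems.LacunarySymmetroidMatrixDescartesCensusCurrency
import Summits.ValiantsHypothesis.ValiantsHypothesis.Theorems.LacunarySymmetroidMatrixDescartesCensusM2K3R11
import Summits.ValiantsHypothesis.ValiantsHypothesis.Theorems.LacunarySymmetroidMatrixDescartesCensusM3K3L1
import Summits.ValiantsHypothesis.ValiantsHypothesis.Theorems.LacunarySymmetroidMatrixDescartesCensusM4K3L2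
import Summits.ValiantsHypothesis.ValiantsHypothesis.Theorems.LacunarySymmetroidMatrixDescartesCensusM5K3L1
import Summits.ValiantsHypothesis.ValiantsHypothesis.Theorems.LacunarySymmetroidMatrixDescartesCensusM2K5GL
import Summits.ValiantsHypothesis.ValiantsHypothesis.Theorems.LacunarySymmetroidMatrixDescartesCensusM2K6B
import Summits.ValiantsHypothesis.ValiantsHypothesis.Theorems.LacunarySymmetroidMatrixDescartesCensusM2K7B
import Summits.ValiantsHypothesis.ValiantsHypothesis.Theorems.LacunarySymmetroidMatrixDescartesCensusM6K3L1
import Summits.ValiantsHypothesis.ValiantsHypothesis.Theorems.LacunarySymmetroidMatrixDescartesCensusM2K6K16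
import Summits.ValiantsHypothesis.ValiantsHypothesis.Theorems.LacunarySymmetroidMatrixDescartesCensusM4K4T25
import Summits.ValiantsHypothesis.ValiantsHypothesis.Theorems.LacunarySymmetroidMatrixDescartesCensusM2K8G25
import Summits.ValiantsHypothesis.ValiantsHypothesis.Theorems.LacunarySymmetroidMatrixDescartesCensusM2K9T27
import Summits.ValiantsHypothesis.ValiantsHypothesis.Theorems.LacunarySymmetroidMatrixDescartesCensusM2K10T29
import Summits.ValiantsHypothesis.ValiantsHypothesis.Theorems.LacunarySymmetroidMatrixDescartesCensusM3K4F18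
import Summits.ValiantsHypothesis.ValiantsHypothesis.Theorems.LacunarySymmetroidMatrixDescartesCensusM3K5F22
import Summits.ValiantsHypothesis.ValiantsHypothesis.Theorems.LacunarySymmetroidMatrixDescartesCensusM4K4F22
import Summits.ValiantsHypothesis.ValiantsHypothesis.Theorems.LacunarySymmetroidMatrixDescartesCensusM3K6F26
import Summits.ValiantsHypothesis.ValiantsHypothesis.Theorems.LacunarySymmetroidMatrixDescartesCensusM2K5T14
import Summits.ValiantsHypothesis.ValiantsHypothesis.Theorems.LacunarySymmetroidMatrixDescartesCensusM7K3L1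
import Summits.ValiantsHypothesis.ValiantsHypothesis.Theorems.LacunarySymmetroidMatrixDescartesCensusM2K6G18
import Summits.ValiantsHypothesis.ValiantsHypothesis.Theorems.LacunarySymmetroidMatrixDescartesCensusM2K7T21
import Summits.ValiantsHypothesis.ValiantsHypothesis.Theorems.LacunarySymmetroidMatrixDescartesCensusM2K9G23
import Summits.ValiantsHypothesis.ValiantsHypothesis.Theorems.LacunarySymmetroidMatrixDescartesCensusM2K10G25
import Summits.ValiantsHypothesis.ValiantsHypothesis.Theorems.LacunarySymmetroidMatrixDescartesCensusClassicalRows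
import Summits.ValiantsHypothesis.ValiantsHypothesis.Theorems.LacunarySymmetroidMatrixDescartesCensusM3K5T27
import Summits.ValiantsHypothesis.ValiantsHypothesis.Theorems.LacunarySymmetroidMatrixDescartesCensusM3K7I30
import Summits.ValiantsHypothesis.ValiantsHypothesis.Theorems.LacunarySymmetroidMatrixDescartesCensusM3K8P33
import Summits.ValiantsHypothesis.ValiantsHypothesis.Theorems.LacunarySymmetroidMatrixDescartesCensusM2K11P31
import Summits.ValiantsHypothesis.ValiantsHypothesis.Theorems.LacunarySymmetroidMatrixDescartesCensusM2K12P33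
import Summits.ValiantsHypothesis.ValiantsHypothesis.Theorems.LacunarySymmetroidMatrixDescartesCensusM4K4C28
import Summits.ValiantsHypothesis.ValiantsHypothesis.Theorems.LacunarySymmetroidMatrixDescartesCensusM5K4C36
import Summits.ValiantsHypothesis.ValiantsHypothesis.Theorems.LacunarySymmetroidMatrixDescartesCensusM4K5T31
import Summits.ValiantsHypothesis.ValiantsHypothesis.Theorems.LacunarySymmetroidMatrixDescartesCensusM3K6T30
import Summits.ValiantsHypothesis.ValiantsHypothesis.Theorems.LacunarySymmetroidMatrixDescartesCensusM2K9I28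
import Summits.ValiantsHypothesis.ValiantsHypothesis.Theorems.LacunarySymmetroidMatrixDescartesCensusM2K10I30
import Summits.ValiantsHypothesis.ValiantsHypothesis.Theorems.LacunarySymmetroidMatrixDescartesCensusM2K11I32
import Summits.ValiantsHypothesis.ValiantsHypothesis.Theorems.LacunarySymmetroidMatrixDescartesCensusM2K12P34
import Summits.ValiantsHypothesis.ValiantsHypothesis.Theorems.LacunarySymmetroidMatrixDescartesCensusM5K4C37
import Summits.ValiantsHypothesis.ValiantsHypothesis.Theorems.LacunarySymmetroidMatrixDescartesCensusM2K13L36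
import Summits.ValiantsHypothesis.ValiantsHypothesis.Theorems.LacunarySymmetroidMatrixDescartesCensusM3K7F35
import Summits.ValiantsHypothesis.ValiantsHypothesis.Theorems.LacunarySymmetroidMatrixDescartesCensusM2K7C22

/-!
# `MatrixDescartes` — the census TABLE OF RECORD, kernel rows (cell `pub-symmetroid`, `HOME/CENSUS.md`)

HONEST FRAMING.  Finite data about small formats `(m, K)` of real symmetric lacunary pencils; nothing here bears
on the asymptotic crux `Theses.LacunarySymmetroid.MatrixDescartes` (stmt-ValiantsHypothesis-18050) except as pattern
evidence, and nothing is claimed about `VP ≠ VNP`.  Each DECIDED row of the cell's table is one theorem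
`row_m_K : PosRootLawAt m K D ∧ ¬ PosRootLawAt m K (D − 1)` (for `(2,4)`: the Certificates file's
`posRootLaw_two_four_sharp`), i.e. `ζ(m,K) = D` exactly, where `ζ(m,K)` is the
maximal number of distinct positive real zeros of `det (∑ l, X^(d l) • S l)` over all `K`-term symmetric `m × m`
pencils: the `≤` half is the Descartes ceiling `D(m,K) = C(m+K−1, m) − 1` (tree `stub_descartesCeiling`, packaged as
`posRootLawAt_descartes`), the `≥` half is the kernel certificate of the row of record (sign alternation of the
closed-form determinant at rational points).  By `posRootLawAt_iff_realRootLawAt` /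
`not_realRootLawAt_of_not_posRootLawAt` every row is restated in the crux's own currency (all distinct real
zeros): `M(m,K) = 2ζ(m,K) + 1` (`rowM_m_K`).  Rows: `(2,3) = 5`, `(3,3) = 9`, `(4,3) = 14`, `(5,3) = 20` (the
`K = 3` column is Descartes-extremal through `m = 5`), `(2,4) = 9`.  Thin formats carry only their certified LOWER halves
here: `l2_lower_four_to_seven` (`ζ(2,K) ≥ 3K − 3`, `K = 4…7`, the lower half of the cell's Conjecture L2); the
classical rows for all sizes (`ζ(m,2) = m`, `ζ(1,K) = K − 1`) are in the ClassicalRows file.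
-/

-- `Summit.ValiantsHypothesis.ValiantsHypothesis.…` repeats a component by the D-0017 layout
-- (single-conjunct summit), which the `dupNamespace` linter flags; the name is mandated.
set_option linter.dupNamespace false

namespace Summit.ValiantsHypothesis.ValiantsHypothesis.Theorems.LacunarySymmetroidMatrixDescartes.Census

open Summit.ValiantsHypothesis.ValiantsHypothesis.Theorems.MatrixDescartes.Negative (PosRootLawAt)

/-- The Descartes ceiling at a concrete format, with the binomial evaluated. [folklore] -/
theorem posRootLawAt_of_eq {m K D : ℕ} (hK : 0 < K) (hD : Nat.choose (m + K - 1) m - 1 = D) :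
    PosRootLawAt m K D := hD ▸ posRootLawAt_descartes m K hK

/-- **Row `(2,3)`: `ζ(2,3) = 5 = D(2,3)`** (row of record S-2-3-lead-0001 = R11; certificate `M2K3R11`). [folklore] -/
theorem row_2_3 : PosRootLawAt 2 3 5 ∧ ¬ PosRootLawAt 2 3 4 :=
  ⟨posRootLawAt_of_eq (by norm_num) (by decide), M2K3R11.not_posRootLawAt⟩

/-- **Row `(3,3)`: `ζ(3,3) = 9 = D(3,3)`** (row of record S-3-3-lead-0001; certificate `M3K3L1`). [folklore] -/
theorem row_3_3 : PosRootLawAt 3 3 9 ∧ ¬ PosRootLawAt 3 3 8 :=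
  ⟨posRootLawAt_of_eq (by norm_num) (by decide), M3K3L1.not_posRootLawAt⟩

/-- **Row `(4,3)`: `ζ(4,3) = 14 = D(4,3)`** (row of record S-4-3-lead-0002; certificate `M4K3L2`). [folklore] -/
theorem row_4_3 : PosRootLawAt 4 3 14 ∧ ¬ PosRootLawAt 4 3 13 :=
  ⟨posRootLawAt_of_eq (by norm_num) (by decide), M4K3L2.not_posRootLawAt⟩

/-- **Row `(5,3)`: `ζ(5,3) = 20 = D(5,3)`** (row of record S-5-3-lead-0001; certificate `M5K3L1`). [folklore] -/
theorem row_5_3 : PosRootLawAt 5 3 20 ∧ ¬ PosRootLawAt 5 3 19 :=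
  ⟨posRootLawAt_of_eq (by norm_num) (by decide), M5K3L1.not_posRootLawAt⟩

-- Row `(2,4)`: `ζ(2,4) = 9 = D(2,4)` IS the already-landed `posRootLaw_two_four_sharp` (Certificates file; row of
-- record = the tree witness `W24`) — not restated here (one declaration per fact).

/-- The same rows in the crux's currency (all distinct real zeros): `M(m,K) = 2ζ(m,K) + 1`. [folklore] -/
theorem rowM_2_3 : RealRootLawAt 2 3 11 ∧ ¬ RealRootLawAt 2 3 10 :=
  ⟨(posRootLawAt_iff_realRootLawAt 2 3 5).1 row_2_3.1, not_realRootLawAt_of_not_posRootLawAt (by norm_num) row_2_3.2⟩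

/-- `M(3,3) = 19`. [folklore] -/
theorem rowM_3_3 : RealRootLawAt 3 3 19 ∧ ¬ RealRootLawAt 3 3 18 :=
  ⟨(posRootLawAt_iff_realRootLawAt 3 3 9).1 row_3_3.1, not_realRootLawAt_of_not_posRootLawAt (by norm_num) row_3_3.2⟩

/-- `M(4,3) = 29`. [folklore] -/
theorem rowM_4_3 : RealRootLawAt 4 3 29 ∧ ¬ RealRootLawAt 4 3 28 :=
  ⟨(posRootLawAt_iff_realRootLawAt 4 3 14).1 row_4_3.1, not_realRootLawAt_of_not_posRootLawAt (by norm_num) row_4_3.2⟩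

/-- `M(5,3) = 41`. [folklore] -/
theorem rowM_5_3 : RealRootLawAt 5 3 41 ∧ ¬ RealRootLawAt 5 3 40 :=
  ⟨(posRootLawAt_iff_realRootLawAt 5 3 20).1 row_5_3.1, not_realRootLawAt_of_not_posRootLawAt (by norm_num) row_5_3.2⟩

/-- `M(2,4) = 19`. [folklore] -/
theorem rowM_2_4 : RealRootLawAt 2 4 19 ∧ ¬ RealRootLawAt 2 4 18 :=
  ⟨(posRootLawAt_iff_realRootLawAt 2 4 9).1 posRootLaw_two_four_sharp.1,
    not_realRootLawAt_of_not_posRootLawAt (by norm_num) posRootLaw_two_four_sharp.2⟩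

/-- **Conjecture L2, lower half, `K = 4 … 7`** (lead R18): `ζ(2,K) ≥ 3K − 3`, i.e. `¬ PosRootLawAt 2 K (3K − 4)`, from
the certified rows `W24` (`K = 4`), `M2K5GL`, `M2K6B`, `M2K7B` (engine-2's Gram-LM and «+3 bump» rows).  The upper half
`ζ(2,K) ≤ 3K − 3` (deficiency below the Descartes count `(K²+K−2)/2` for `K ≥ 5`) is OPEN. [folklore] -/
theorem l2_lower_four_to_seven (K : ℕ) (h4 : 4 ≤ K) (h7 : K ≤ 7) : ¬ PosRootLawAt 2 K (3 * K - 4) := by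
  interval_cases K
  · exact posRootLaw_two_four_sharp.2
  · exact M2K5GL.not_posRootLawAt
  · exact M2K6B.not_posRootLawAt
  · exact M2K7B.not_posRootLawAt

/-! ## Rows appended 2026-08-22 (typer gen 2): `(6,3) = 27`, the `K = 3` column `m ≤ 6` as one statement, bounds at `(2,6)`, `(2,7)` -/

/-- **Row `(6,3)`: `ζ(6,3) = 27 = D(6,3)`** — row of record `S-6-3-lead-0001` (lead, two-stage determinantal homotopy;
re-counted by engine-1 `symdet`/`naive_ref` and field-certified by the referee), kernel certificate `Census.M6K3L1`;
the `≤` half is the Descartes ceiling `C(8,6) − 1 = 27`. [folklore] -/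
theorem row_6_3 : PosRootLawAt 6 3 27 ∧ ¬ PosRootLawAt 6 3 26 :=
  ⟨posRootLawAt_of_eq (by norm_num) (by decide), M6K3L1.not_posRootLawAt⟩

/-- Row `(6,3)` in the crux's currency (all distinct real zeros): `M(6,3) = 55`. [folklore] -/
theorem rowM_6_3 : RealRootLawAt 6 3 55 ∧ ¬ RealRootLawAt 6 3 54 :=
  ⟨(posRootLawAt_iff_realRootLawAt 6 3 27).1 row_6_3.1,
    not_realRootLawAt_of_not_posRootLawAt (by norm_num) row_6_3.2⟩

/-- **The `K = 3` column is Descartes-extremal for every size `m ≤ 6`**: `ζ(m,3) = C(m+2,2) − 1` (`= 2, 5, 9, 14, 20,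
27`), i.e. the cell's Conjecture A3 (`CONJECTURE.md` §3: `ζ(m,3) = C(m+2,2) − 1` for all `m`) holds in the kernel
through `m = 6` — `m = 1` is Descartes sharpness for trinomials (`row_one 3`), `m = 2 … 6` are the census rows of
record.  A3 itself (all `m`) is OPEN and is NOT asserted anywhere in the tree. [folklore] -/
theorem a3_column_le_six (m : ℕ) (h1 : 1 ≤ m) (h6 : m ≤ 6) :
    PosRootLawAt m 3 (Nat.choose (m + 2) 2 - 1) ∧ ¬ PosRootLawAt m 3 (Nat.choose (m + 2) 2 - 2) := by
  interval_cases m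
  · exact row_one 3 (by norm_num)
  · exact row_2_3
  · exact row_3_3
  · exact row_4_3
  · exact row_5_3
  · exact row_6_3

/-- **Bounds of record at `(2,6)`: `16 ≤ ζ(2,6) ≤ 20`** — lower half = engine-1's graft row `E1-S-2-6-BUMP16-1613-00`
(`Census.M2K6K16`, one above the dead L2 value `15`), upper half = Descartes `C(7,2) − 1`.  (The other thin formats with a
certificate — `(2,5)`, `(3,4)`, `(4,4)`, `(3,5)` — have their `bounds_m_K` in the LawsRefuted file.) [folklore] -/
theorem bounds_2_6 : ¬ PosRootLawAt 2 6 15 ∧ PosRootLawAt 2 6 20 :=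
  ⟨M2K6K16.not_posRootLawAt, posRootLawAt_of_eq (by norm_num) (by decide)⟩

/-- **Bounds of record at `(2,7)`: `18 ≤ ζ(2,7) ≤ 27`** (`Census.M2K7B` / Descartes `C(8,2) − 1`). [folklore] -/
theorem bounds_2_7 : ¬ PosRootLawAt 2 7 17 ∧ PosRootLawAt 2 7 27 :=
  ⟨M2K7B.not_posRootLawAt, posRootLawAt_of_eq (by norm_num) (by decide)⟩

/-! ## Rows appended 2026-08-22 (typer gen 2, second batch): `(2,5) = 14`, `(7,3) = 35`, the `K = 3` column `m ≤ 7`, thin-format bounds -/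

/-- **Row `(2,5)`: `ζ(2,5) = 14 = D(2,5)`** — DECIDED (lead R30): the theory seat's γ = 3 graft rows `T-GRAFT14-2-5-*`
(re-counted by the lead and the referee), kernel certificate `Census.M2K5T14` (small row `T-GRAFT14-2-5-0-2-3-9-120`); the
`≤` half is the Descartes ceiling `C(6,2) − 1 = 14`.  Kernel history of the row: `≥ 12` (`M2K5GL`), `≥ 13` (`M2K5K13`),
`= 14`. [folklore] -/
theorem row_2_5 : PosRootLawAt 2 5 14 ∧ ¬ PosRootLawAt 2 5 13 :=
  ⟨posRootLawAt_of_eq (by norm_num) (by decide), M2K5T14.not_posRootLawAt⟩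

/-- Row `(2,5)` in the crux's currency (all distinct real zeros): `M(2,5) = 29`. [folklore] -/
theorem rowM_2_5 : RealRootLawAt 2 5 29 ∧ ¬ RealRootLawAt 2 5 28 :=
  ⟨(posRootLawAt_iff_realRootLawAt 2 5 14).1 row_2_5.1,
    not_realRootLawAt_of_not_posRootLawAt (by norm_num) row_2_5.2⟩

/-- **Row `(7,3)`: `ζ(7,3) = 35 = D(7,3)`** — row of record `S-7-3-lead-0001` (lead R27/R29, determinantal homotopy + exact
rounding ladder; referee field-certified `(35,3,0)`), kernel certificate `Census.M7K3L1`; the `≤` half is the Descartes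
ceiling `C(9,7) − 1 = 35`. [folklore] -/
theorem row_7_3 : PosRootLawAt 7 3 35 ∧ ¬ PosRootLawAt 7 3 34 :=
  ⟨posRootLawAt_of_eq (by norm_num) (by decide), M7K3L1.not_posRootLawAt⟩

/-- Row `(7,3)` in the crux's currency (all distinct real zeros): `M(7,3) = 71`. [folklore] -/
theorem rowM_7_3 : RealRootLawAt 7 3 71 ∧ ¬ RealRootLawAt 7 3 70 :=
  ⟨(posRootLawAt_iff_realRootLawAt 7 3 35).1 row_7_3.1,
    not_realRootLawAt_of_not_posRootLawAt (by norm_num) row_7_3.2⟩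

/-- **The `K = 3` column is Descartes-extremal for every size `m ≤ 7`**: `ζ(m,3) = C(m+2,2) − 1` (`= 2, 5, 9, 14, 20, 27,
35`) — the cell's Conjecture A3 (`KThreeColumnLaw`) holds in the kernel through `m = 7`; A3 itself (all `m`) stays OPEN
here and is not asserted. [folklore] -/
theorem a3_column_le_seven (m : ℕ) (h1 : 1 ≤ m) (h7 : m ≤ 7) :
    PosRootLawAt m 3 (Nat.choose (m + 2) 2 - 1) ∧ ¬ PosRootLawAt m 3 (Nat.choose (m + 2) 2 - 2) := by
  by_cases h6 : m ≤ 6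
  · exact a3_column_le_six m h1 h6
  · obtain rfl : m = 7 := by omega
    exact row_7_3

/-- **Bounds of record at `(2,6)`: `18 ≤ ζ(2,6) ≤ 20`** (`Census.M2K6G18`, engine-2 GRAFT18; supersedes the lower half `16` of `bounds_2_6`). [folklore] -/
theorem bounds_2_6' : ¬ PosRootLawAt 2 6 17 ∧ PosRootLawAt 2 6 20 :=
  ⟨M2K6G18.not_posRootLawAt, bounds_2_6.2⟩

/-- **Bounds of record at `(2,7)`: `21 ≤ ζ(2,7) ≤ 27`** (`Census.M2K7T21`, theory T-GRAFT21; supersedes `bounds_2_7` (18) and `M2K7G19` (19)). [folklore] -/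
theorem bounds_2_7'' : ¬ PosRootLawAt 2 7 20 ∧ PosRootLawAt 2 7 27 :=
  ⟨M2K7T21.not_posRootLawAt, bounds_2_7.2⟩

/-- **Bounds of record at `(2,9)`: `23 ≤ ζ(2,9) ≤ 44`** (`Census.M2K9G23` (GRAFT23) / Descartes `C(10,2) − 1`). [folklore] -/
theorem bounds_2_9 : ¬ PosRootLawAt 2 9 22 ∧ PosRootLawAt 2 9 44 :=
  ⟨M2K9G23.not_posRootLawAt, posRootLawAt_of_eq (by norm_num) (by decide)⟩

/-- **Bounds of record at `(2,10)`: `25 ≤ ζ(2,10) ≤ 54`** (`Census.M2K10G25` (GRAFT25) / Descartes `C(11,2) − 1`). [folklore] -/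
theorem bounds_2_10 : ¬ PosRootLawAt 2 10 24 ∧ PosRootLawAt 2 10 54 :=
  ⟨M2K10G25.not_posRootLawAt, posRootLawAt_of_eq (by norm_num) (by decide)⟩

/-! ## Rows appended 2026-08-22 (typer gen 2, third batch): kernel bounds of the thin formats after the graft/flag rows -/

/-- **Bounds of record at `(2,8)`: `25 ≤ ζ(2,8) ≤ 35`** (`Census.M2K8G25`, engine-2 double graft (lead R33); `Census.M2K8G21` / `M2K8B` give 21 / 20; upper half = Descartes `C(9,2) − 1`). [folklore] -/
theorem bounds_2_8 : ¬ PosRootLawAt 2 8 24 ∧ PosRootLawAt 2 8 35 :=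
  ⟨M2K8G25.not_posRootLawAt, posRootLawAt_of_eq (by norm_num) (by decide)⟩

/-- **Bounds of record at `(2,9)`: `27 ≤ ζ(2,9) ≤ 44`** (`Census.M2K9T27`, theory γ = 0 graft (lead R37); supersedes `bounds_2_9` (23); upper half = Descartes `C(10,2) − 1`). [folklore] -/
theorem bounds_2_9' : ¬ PosRootLawAt 2 9 26 ∧ PosRootLawAt 2 9 44 :=
  ⟨M2K9T27.not_posRootLawAt, posRootLawAt_of_eq (by norm_num) (by decide)⟩

/-- **Bounds of record at `(2,10)`: `29 ≤ ζ(2,10) ≤ 54`** (`Census.M2K10T29`, theory γ = 0 graft (lead R37); supersedes `bounds_2_10` (25); upper half = Descartes `C(11,2) − 1`). [folklore] -/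
theorem bounds_2_10' : ¬ PosRootLawAt 2 10 28 ∧ PosRootLawAt 2 10 54 :=
  ⟨M2K10T29.not_posRootLawAt, posRootLawAt_of_eq (by norm_num) (by decide)⟩

/-- **Bounds of record at `(3,4)`: `18 ≤ ζ(3,4) ≤ 19`** (`Census.M3K4F18`, engine-2 flag graft (lead R30/R35); supersedes `bounds_3_4` (16, LawsRefuted file); general pencils attain 19 (`Census.G3K4E1`); upper half = Descartes `C(6,3) − 1`). [folklore] -/
theorem bounds_3_4' : ¬ PosRootLawAt 3 4 17 ∧ PosRootLawAt 3 4 19 :=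
  ⟨M3K4F18.not_posRootLawAt, posRootLawAt_of_eq (by norm_num) (by decide)⟩

/-- **Bounds of record at `(3,5)`: `22 ≤ ζ(3,5) ≤ 34`** (`Census.M3K5F22` (lead R35); supersedes `bounds_3_5` (20); the census row of record ≥ 27 has 1200-digit entries and no kernel certificate; upper half = Descartes `C(7,3) − 1`). [folklore] -/
theorem bounds_3_5' : ¬ PosRootLawAt 3 5 21 ∧ PosRootLawAt 3 5 34 :=
  ⟨M3K5F22.not_posRootLawAt, posRootLawAt_of_eq (by norm_num) (by decide)⟩

/-- **Bounds of record at `(4,4)`: `22 ≤ ζ(4,4) ≤ 34`** (`Census.M4K4F22` (lead R35/R37); supersedes `bounds_4_4` (21); rows ≥ 23 / ≥ 25 of record exceed one gate file; upper half = Descartes `C(7,4) − 1`). [folklore] -/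
theorem bounds_4_4' : ¬ PosRootLawAt 4 4 21 ∧ PosRootLawAt 4 4 34 :=
  ⟨M4K4F22.not_posRootLawAt, posRootLawAt_of_eq (by norm_num) (by decide)⟩

/-- **Bounds of record at `(3,6)`: `26 ≤ ζ(3,6) ≤ 55`** (`Census.M3K6F26` (lead R35), first (3,6) kernel row; the row of record ≥ 30 (2888-digit entries) has no kernel certificate; upper half = Descartes `C(8,3) − 1`). [folklore] -/
theorem bounds_3_6 : ¬ PosRootLawAt 3 6 25 ∧ PosRootLawAt 3 6 55 :=
  ⟨M3K6F26.not_posRootLawAt, posRootLawAt_of_eq (by norm_num) (by decide)⟩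

/-! ## Row appended 2026-08-22 (typer gen 2, fourth batch): `(4,4) ≥ 25` -/

/-- **Bounds of record at `(4,4)`: `25 ≤ ζ(4,4) ≤ 34`** (`Census.M4K4T25`, theory (g3)'s kernel-sized flag row
`T-FLAG25-4-4-0-4-5-214-mir`, lead R40: OF RECORD with an exact second code; `25 = P(4,4) + 1` where `P = K·m(m+1)/2 − m² = 24`;
supersedes `bounds_4_4'` (22) and `bounds_4_4` (21); upper half = Descartes `C(7,4) − 1`).  By the fork theorem
(`Census.not_matrixDescartes_of_formatExtremal`, format `(K², K)`) the square-ish formats are exactly where the crux REQUIRES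
Descartes-deficiency eventually; the cell does NOT conjecture `(4,4) = 34` (lead R45). [folklore] -/
theorem bounds_4_4'' : ¬ PosRootLawAt 4 4 24 ∧ PosRootLawAt 4 4 34 :=
  ⟨M4K4T25.not_posRootLawAt, posRootLawAt_of_eq (by norm_num) (by decide)⟩

/-! ## Rows appended 2026-08-23 (typer gen 3, fifth batch): `(3,5) ≥ 27`, `(3,7) ≥ 30`, `(3,8) ≥ 33`, `(2,11) ≥ 31`,
`(2,12) ≥ 33`, `(4,4) ≥ 28`, `(5,4) ≥ 36`, `(4,5) ≥ 31`, `(3,6) ≥ 30`; and `k1_baseline`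

Certificates of this batch use the compact form of `LacunarySymmetroidMatrixDescartesCensusKit` (normalised pencil,
single literal; `det` by the Laplace lemmas of `…CensusDetLaplace` at `m = 4, 5`), which is what brought the rows of
record with several-hundred-digit entries under the gate's file-size limit.  As before: lower half = an explicit
symmetric witness, upper half = Descartes' rule (`posRootLawAt_of_eq`); no format here is conjectured extremal or
deficient by the cell (lead R45: the square-ish formats are fork-regime data). -/

/-- **Bounds of record at `(3,5)`: `27 ≤ ζ(3,5) ≤ 34`** (`Census.M3K5T27`, theory (g2)'s flag row
`T-FLAG27-3-5-0-355-358-359-1408-mir`, the census value OF RECORD (lead R36; exact count 27 by a second code);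
supersedes `bounds_3_5'` (22) and `Census.M3K5T26`; upper half = Descartes `C(7,3) − 1`). [folklore] -/
theorem bounds_3_5'' : ¬ PosRootLawAt 3 5 26 ∧ PosRootLawAt 3 5 34 :=
  ⟨M3K5T27.not_posRootLawAt, posRootLawAt_of_eq (by norm_num) (by decide)⟩

/-- **Bounds at `(3,7)`: `30 ≤ ζ(3,7) ≤ 83`** (`Census.M3K7I30`, engine-3's small-entry isotropic-flag row
`E3-ISO30-3-7-0-21-23-30-43-51-64`; `Census.M3K7P27` gives 27 from an exactly counted row; the census rows of record read
`≥ 33 … 35` (2900–6300-digit entries, no kernel certificate); upper half = Descartes `C(9,3) − 1`). [folklore] -/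
theorem bounds_3_7 : ¬ PosRootLawAt 3 7 29 ∧ PosRootLawAt 3 7 83 :=
  ⟨M3K7I30.not_posRootLawAt, posRootLawAt_of_eq (by norm_num) (by decide)⟩

/-- **Bounds at `(3,8)`: `33 ≤ ζ(3,8) ≤ 119`** (`Census.M3K8P33`, engine-3's small-entry row
`E3-PLUS33-3-8-0-21-23-30-43-51-64-65`; `Census.M3K8P30` gives 30 from an exactly counted row; the census rows of record
read `≥ 36 … 39` (3100–7500-digit entries, no kernel certificate); upper half = Descartes `C(10,3) − 1`). [folklore] -/
theorem bounds_3_8 : ¬ PosRootLawAt 3 8 32 ∧ PosRootLawAt 3 8 119 :=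
  ⟨M3K8P33.not_posRootLawAt, posRootLawAt_of_eq (by norm_num) (by decide)⟩

/-- **Bounds of record at `(2,11)`: `31 ≤ ζ(2,11) ≤ 65`** (`Census.M2K11P31`, engine-3's `+2` end-graft chain row
`E3-PLUS31-2-11-…-611` (lead R52, three codes); supersedes `Census.M2K11G27`; `31 = P(2,11) + 2`; upper half =
Descartes `C(12,2) − 1`). [folklore] -/
theorem bounds_2_11 : ¬ PosRootLawAt 2 11 30 ∧ PosRootLawAt 2 11 65 :=
  ⟨M2K11P31.not_posRootLawAt, posRootLawAt_of_eq (by norm_num) (by decide)⟩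

/-- **Bounds of record at `(2,12)`: `33 ≤ ζ(2,12) ≤ 77`** (`Census.M2K12P33`, engine-3's chain row
`E3-PLUS33-2-12-…-626` (lead R52, three codes); first `(2,12)` kernel row; `33 = P(2,12) + 1`; upper half = Descartes
`C(13,2) − 1`). [folklore] -/
theorem bounds_2_12 : ¬ PosRootLawAt 2 12 32 ∧ PosRootLawAt 2 12 77 :=
  ⟨M2K12P33.not_posRootLawAt, posRootLawAt_of_eq (by norm_num) (by decide)⟩

/-- **Bounds of record at `(4,4)`: `28 ≤ ζ(4,4) ≤ 34`** (`Census.M4K4C28`, engine-4's CAP construction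
`E4-CAP28-4-4-0-1-4-623-on-T-m3K3-d0-1-4-n9-s2-r6b-g9` (lead R55); `28 = P(4,4) + 4 = D(4,4) − 6`; supersedes
`bounds_4_4''` (25), `bounds_4_4'` (22), `bounds_4_4` (21); upper half = Descartes `C(7,4) − 1`). [folklore] -/
theorem bounds_4_4''' : ¬ PosRootLawAt 4 4 27 ∧ PosRootLawAt 4 4 34 :=
  ⟨M4K4C28.not_posRootLawAt, posRootLawAt_of_eq (by norm_num) (by decide)⟩

/-- **Bounds of record at `(5,4)`: `36 ≤ ζ(5,4) ≤ 55`** (`Census.M5K4C36`, engine-4's CAP+FLAG row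
`E4-CAP36-5-4-0-1-5-1347-on-E1-S-4-3-small-1513-01-s1` (lead R60); `Census.M5K4E35` (flag row `E4-FLAG35-…-534-mir-s1`,
lead R51, three codes) gives 35 = `P(5,4)`; upper half = Descartes `C(8,5) − 1`). [folklore] -/
theorem bounds_5_4 : ¬ PosRootLawAt 5 4 35 ∧ PosRootLawAt 5 4 55 :=
  ⟨M5K4C36.not_posRootLawAt, posRootLawAt_of_eq (by norm_num) (by decide)⟩

/-- **Bounds of record at `(4,5)`: `31 ≤ ζ(4,5) ≤ 69`** (`Census.M4K5T31`, theory (g3)'s flag row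
`T-FLAG31-4-5-0-2-10-17-938` (lead R39/R40, legs by lead and referee); first `(4,5)` kernel row; `P(4,5) = 34`; upper
half = Descartes `C(8,4) − 1`). [folklore] -/
theorem bounds_4_5 : ¬ PosRootLawAt 4 5 30 ∧ PosRootLawAt 4 5 69 :=
  ⟨M4K5T31.not_posRootLawAt, posRootLawAt_of_eq (by norm_num) (by decide)⟩

/-- **Bounds of record at `(3,6)`: `30 ≤ ζ(3,6) ≤ 55`** (`Census.M3K6T30`, theory (g2)'s exact hierarchical graft row
`T-PLUS30-3-6-0-355-358-359-1408-2108`, the census value of record (lead R37; 2888-digit entries before normalisation);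
supersedes `bounds_3_6` (26); `30 = P(3,6) + 3`; upper half = Descartes `C(8,3) − 1`). [folklore] -/
theorem bounds_3_6' : ¬ PosRootLawAt 3 6 29 ∧ PosRootLawAt 3 6 55 :=
  ⟨M3K6T30.not_posRootLawAt, posRootLawAt_of_eq (by norm_num) (by decide)⟩

/-- **K1 baseline (coordinator focus 2026-08-23: «decide (2,6) and (3,4) exactly»).**  What the kernel holds for the
two formats, under one name: `18 ≤ ζ(2,6) ≤ 20 = D(2,6)` and `18 ≤ ζ(3,4) ≤ 19 = D(3,4)` (lower halves: explicit symmetric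
witnesses `Census.M2K6G18`, `Census.M3K4F18`; upper halves: Descartes).  The open alternatives are exactly the laws
`PosRootLawAt 2 6 19`, `PosRootLawAt 2 6 18` (a format-level Descartes deficiency of 1 resp. 2 at `(2,6)`) and
`PosRootLawAt 3 4 18` (deficiency 1 at `(3,4)`; general, non-symmetric pencils DO reach 19: `Census.G3K4E1.card_posRoots_eq`)
— each refutable by one witness row, provable only by a format-level argument.  No side is asserted here. [folklore] -/
theorem k1_baseline :
    (¬ PosRootLawAt 2 6 17 ∧ PosRootLawAt 2 6 20) ∧ (¬ PosRootLawAt 3 4 17 ∧ PosRootLawAt 3 4 19) :=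
  ⟨bounds_2_6', bounds_3_4'⟩

/-! ## Rows appended 2026-08-23 (typer gen 3, sixth batch): `(2,9) ≥ 28`, `(2,10) ≥ 30`, `(2,11) ≥ 32`, `(2,12) ≥ 34`,
`(5,4) ≥ 37` — engine-3's isotropic-flag / `+2` chain rows and engine-4's CAP+FLAG row of 2026-08-23T02–03Z. -/

/-- **Bounds at `(2,9)`: `28 ≤ ζ(2,9) ≤ 44`** (`Census.M2K9I28`, engine-3's isotropic-flag row
`E3-ISO28-2-9-0-82-86-87-89-99-107-348-590`; supersedes `bounds_2_9'` (27); `28 = P(2,9) + 5`; upper half = Descartes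
`C(10,2) − 1`). [folklore] -/
theorem bounds_2_9'' : ¬ PosRootLawAt 2 9 27 ∧ PosRootLawAt 2 9 44 :=
  ⟨M2K9I28.not_posRootLawAt, posRootLawAt_of_eq (by norm_num) (by decide)⟩

/-- **Bounds at `(2,10)`: `30 ≤ ζ(2,10) ≤ 54`** (`Census.M2K10I30`, engine-3's row
`E3-ISO30-2-10-0-82-86-87-89-99-107-348-520-693`; supersedes `bounds_2_10'` (29); `30 = P(2,10) + 4`; upper half =
Descartes `C(11,2) − 1`). [folklore] -/
theorem bounds_2_10'' : ¬ PosRootLawAt 2 10 29 ∧ PosRootLawAt 2 10 54 :=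
  ⟨M2K10I30.not_posRootLawAt, posRootLawAt_of_eq (by norm_num) (by decide)⟩

/-- **Bounds at `(2,11)`: `32 ≤ ζ(2,11) ≤ 65`** (`Census.M2K11I32`, engine-3's row
`E3-ISO32-2-11-0-82-86-87-89-99-107-348-520-600-681`; supersedes `bounds_2_11` (31); `32 = P(2,11) + 3`; upper half =
Descartes `C(12,2) − 1`). [folklore] -/
theorem bounds_2_11' : ¬ PosRootLawAt 2 11 31 ∧ PosRootLawAt 2 11 65 :=
  ⟨M2K11I32.not_posRootLawAt, posRootLawAt_of_eq (by norm_num) (by decide)⟩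

/-- **Bounds at `(2,12)`: `34 ≤ ζ(2,12) ≤ 77`** (`Census.M2K12P34`, engine-3's row
`E3-PLUS34-2-12-0-82-86-87-89-99-107-348-520-600-681-682`; supersedes `bounds_2_12` (33); `34 = P(2,12) + 2`; upper
half = Descartes `C(13,2) − 1`). [folklore] -/
theorem bounds_2_12' : ¬ PosRootLawAt 2 12 33 ∧ PosRootLawAt 2 12 77 :=
  ⟨M2K12P34.not_posRootLawAt, posRootLawAt_of_eq (by norm_num) (by decide)⟩

/-- **Bounds of record at `(5,4)`: `37 ≤ ζ(5,4) ≤ 55`** (`Census.M5K4C37`, engine-4's CAP+FLAG row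
`E4-CAP37-5-4-0-1-5-623-on-T-m4K3-d0-1-5-n14-s3-r4b-g9-s8`, referee g17 leg; supersedes `bounds_5_4` (36);
`37 = P(5,4) + 2`; upper half = Descartes `C(8,5) − 1`). [folklore] -/
theorem bounds_5_4' : ¬ PosRootLawAt 5 4 36 ∧ PosRootLawAt 5 4 55 :=
  ⟨M5K4C37.not_posRootLawAt, posRootLawAt_of_eq (by norm_num) (by decide)⟩

/-! ## Rows appended 2026-08-23 (typer gen 3, seventh batch): `(2,13) ≥ 36` (first row of the format), `(3,7) ≥ 35` (the
census value of record) — both certificates in the generator's `--factor` form (integer numerals printed as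
`core · 2^a · 5^b`, which is what lets rows with several-thousand-digit entries fit one gate file). -/

/-- **Bounds at `(2,13)`: `36 ≤ ζ(2,13) ≤ 90`** (`Census.M2K13L36`, theory-2's live-end append graft row
`T2-LIVE36-2-13-0-82-86-87-89-99-107-348-520-600-611-626-721` on the top end of `E3-PLUS33-2-12`; first `(2,13)` kernel row;
`36 = P(2,13) + 1`; upper half = Descartes `C(14,2) − 1`). [folklore] -/
theorem bounds_2_13 : ¬ PosRootLawAt 2 13 35 ∧ PosRootLawAt 2 13 90 :=
  ⟨M2K13L36.not_posRootLawAt, posRootLawAt_of_eq (by norm_num) (by decide)⟩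

/-- **Bounds of record at `(3,7)`: `35 ≤ ζ(3,7) ≤ 83`** (`Census.M3K7F35`, engine-3's isotropic-flag row
`E3-IFL35-3-7-0-355-358-359-1408-1409-1559`, the census value of record; supersedes `bounds_3_7` (30); `35 = P(3,7) + 2`;
upper half = Descartes `C(9,3) − 1`). [folklore] -/
theorem bounds_3_7' : ¬ PosRootLawAt 3 7 34 ∧ PosRootLawAt 3 7 83 :=
  ⟨M3K7F35.not_posRootLawAt, posRootLawAt_of_eq (by norm_num) (by decide)⟩

/-! ## Row appended 2026-08-23 (typer gen 4, eighth batch): `(2,7) ≥ 22` (engine-1 g5 CHAIN row). -/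

/-- **Bounds of record at `(2,7)`: `22 ≤ ζ(2,7) ≤ 27`** (`Census.M2K7C22`, engine-1 g5's row
`E1G5-CHAIN22-2-7-0-43-45-49-54-57-1200`; supersedes `bounds_2_7''` (21); `22 = P(2,7) + 5`; upper half = Descartes
`C(8,2) − 1`). [folklore] -/
theorem bounds_2_7''' : ¬ PosRootLawAt 2 7 21 ∧ PosRootLawAt 2 7 27 :=
  ⟨M2K7C22.not_posRootLawAt, bounds_2_7.2⟩

end Summit.ValiantsHypothesis.ValiantsHypothesis.Theorems.LacunarySymmetroidMatrixDescartes.Census
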